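import Mathlib
import Literature.NumberTheory.Sieve.ShnirelmanGoldbachHarmonic
import Literature.NumberTheory.LFunctions.ChebyshevCostaPereira
import Literature.NumberTheory.LFunctions.ChebyshevCostaPereira68
import HarnessLib

/-!
# An explicit all-`N` floor for differences of primes (Maillet numbers of level `N`):
# at least `N/82` even `h ≤ N` are `p − q` with primes `q < p ≤ N` (`N ≥ 5`)

Topic `Literature/NumberTheory/Sieve`; namespace `Literature.NumberTheory.Sieve.MailletFloorExplicit`.
Everything here is PROVED (no named facts, no instances, no notation); the two conditional columns carry
their hypothesis explicitly (`RomanoffExplicit.PrimeCountingLowerMul c₀ x₁ := ∀ n ≥ x₁, c₀ n/log n ≤ π(n)`).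
Origin: cell `parity-ideate`, seat p5 g22, ROUND-45 «MAILLET» (pub file `round45/MailletFloor.lean` v2 sha16
`4516738a2a0883b1`, referee parity-ideate-ref g96 FULL PASS), landed re-namespaced with statements and proofs
verbatim.  Inputs (all tree theorems): the explicit prime-pair sieve
`ShnirelmanGoldbachExplicit.pairCount_le_1301 / pairCount_le_1152` (`#{p ≤ N : p + h prime} ≤ A·f(h)·N/log²N`,
`A = 13.01` from `e³⁸`, `A = 11.52` from `e¹⁹⁰`), `ShnirelmanGoldbachExplicit.sum_even_oddSingularFactor_pow8_le`
(`Σ_{even h ≤ x} f(h)⁸ ≤ 259.55·x`) and `CostaPereira.primeCounting_ge` (`π(n) ≥ 0.9636·n/log n`, `n ≥ 227`);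
§5 proves the sixteenth moment `Σ_{even h ≤ x} f(h)¹⁶ ≤ 2.15·10⁶·x` (the architecture of
`ShnirelmanGoldbachFlatten` §14.1 with `8 → 16`).  Literature context: the set of differences of primes has
positive lower density by Brun–Titchmarsh (folklore, no constant in print); on the infinitely-often side
(de Polignac numbers) Pintz [arXiv:1206.0149, Thm 1] and Granville–Kane–Koukoulopoulos–Lemke Oliver
[arXiv:1410.8198, p.3: density `≥ 1/354`] are asymptotic and ineffective; the explicit all-`N` constants below
appear to be new (referee-graded, not a literature claim).

## Statements (`f` = `GoldbachLinnik.oddSingularFactor`, `D_even(N) = {h ∈ [1,N] even : h = p − q, p, q ≤ N primes}`)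
* `even_maillet_floor : 5 ≤ N → N/82 ≤ #D_even(N)` and `maillet_floor : 3 ≤ N → N/82 ≤ #D(N)` (all `h`);
* `even_maillet_floor_holder8 : N/88` (Hölder-8 with the tree's eighth moment only, no §5);
* `even_maillet_floor_RS`, `maillet_floor_RS : N/76` under Rosser–Schoenfeld `π(x) > x/log x` (`x ≥ 17`),
  as the hypothesis `RomanoffExplicit.PrimeCountingLowerMul 1 17`; `even_maillet_floor_CP68 : N/78` under
  the `m = 68` Costa-Pereira-type Chebyshev constant `PrimeCountingLowerMul 0.984437 (4.468041·10⁴²)` (to be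
  discharged by `CostaPereira68.primeCounting_ge_9` once `ChebyshevCostaPereira68.lean` lands — a hypothesis here);
  **§8 discharges it**: `even_maillet_floor_78 : 5 ≤ N → N/78 ≤ #D_even(N)` and `maillet_floor_78 : 3 ≤ N → N/78 ≤ #D(N)`
  UNCONDITIONALLY, the Chebyshev bound being the tree theorem `CostaPereira68.primeCounting_ge_9`
  (`ChebyshevCostaPereira68.lean`, landed);
* the engines `even_count_ge_of_moment` (any moment exponent), `even_count_ge_of` (8), `even_count_ge_of16`
  (16), parametric in `(c₀, x₁, A, Λ, κ)`, and the column-free assembly `even_floor_assemble`.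

## Proof
(1) Exact first moment: ordered prime pairs `q < p ≤ N` inject into `{(h,q) : q, q+h prime ≤ N}` via
`(q,p) ↦ (p−q,q)`, so `Σ_{1≤h≤N} R_N(h) ≥ π(N)(π(N)−1)/2` with `R_N(h) = #{q ≤ N prime : q+h prime ≤ N}`;
odd `h` force `q = 2`, so `Σ_{odd h} R_N(h) ≤ π(N)` and `Σ_{even h} R_N(h) ≥ (π² − 3π)/2`.
(2) Cap: `R_N(h) ≤ #{p ≤ N : p+h prime} ≤ A f(h) N/log²N`, hence on the support `E` of `R_N` among even
`h ≤ N`: `Σ_{h∈E} f(h) ≥ (π²−3π) log²N/(2AN) ≥ (c₀²/(2A) − 10⁻⁴)·N =: μN` (`1.5 log N ≤ 10⁻⁴N` for `N ≥ e³⁸`).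
(3) Hölder (four Cauchy–Schwarz steps): `(Σ_E f)¹⁶ ≤ |E|¹⁵ Σ_E f¹⁶ ≤ |E|¹⁵·2.15·10⁶·N`, so
`|E| ≥ N·(μ¹⁶/2.15·10⁶)^{1/15}`; with `(c₀, A) = (0.9636, 11.52)`: `μ = 0.0402`, `μ¹⁶ = 4.65·10⁻²³ >
2.15·10⁶/82¹⁵ = 4.21·10⁻²³`, i.e. `|E| ≥ N/82` for `N ≥ e¹⁹⁰` (exponent 8 with `259.55`: `N/88`).
(4) `e³⁸ ≤ N < e¹⁹⁰`: `D_even(N) ⊇ (P−3) ∪ (P−5) ∪ (P−7)` and Bonferroni with the pair sieve on the three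
pairwise intersections (`f(2) = f(4) = 1`): `≥ 3π(N) − 9 − 39.03 N/log²N ≥ 0.014 N − 9`.
(5) `227 ≤ N < e³⁸`: `|P − 3| ≥ π(N) − 2 ≥ 0.9636 N/38 − 2`; `13 ≤ N < 227`: `{2,4,6,8,10}`; `5 ≤ N < 13`: `{2}`.

## Near-miss table (the single input varied is the pair-sieve constant `A`; all else fixed)
`K(A)` from step (3) (Hölder-16, `c₀ = 0.9636`): `A = 13.01 → 1/93`; `11.52 → 1/82` (this file); `10.998`
(the 68-cell architecture's limit `A_∞`, cell parity-ideate ROUND-44 §9) `→ 1/78`; `10.56 = 8·(2C₂)` (dimension-2 Selberg with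
the full harmonic constant) `→ 1/75`; `5.28 = 4·(2C₂)` (dimension-1 sieve at Bombieri–Vinogradov level)
`→ 1/36`; `2.64 = 2·(2C₂)` (the parity wall of upper-bound sieves) `→ 1/17`; the truth `2C₂ = 1.32 → 1/9`
(every entry the least INTEGER `K` the Hölder-16 criterion certifies: `K* = 92.8, 81.6, 77.5, 74.2, 35.4, 16.9, 8.06`);
conjecturally every even `h ≤ N − O(1)` is in `D(N)` (`1/2`).  Other levers: `c₀ = 0.9636 → 1` gives
`82 → 76` (the RS column); moment exponent `8 → 16` gave `88 → 82`, and the exact rearrangement dual of the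
same data is `≈ 1/76` (so Hölder-16 is within `7 %` of what `(A, c₀, f)` alone can give).
-/

namespace Literature.NumberTheory.Sieve.MailletFloorExplicit

open Finset Real
open scoped Classical Pointwise
open Literature.NumberTheory.Sieve.GoldbachLinnik (oddSingularFactor oddSingularFactor_nonneg
  oddSingularFactor_two_pow_mul oddSingularFactor_one)
open Literature.NumberTheory.Sieve.ShnirelmanGoldbachExplicit (pairCount_le_1301 pairCount_le_1152
  sum_even_oddSingularFactor_pow8_le)
open Literature.NumberTheory.Sieve.RomanoffExplicit (PrimeCountingLowerMul)

/-! ## §1 The pair count `R_N(h)` and its exact first moment -/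

/-- `R_N(h) = #{q ≤ N prime : q + h prime, q + h ≤ N}` (the representation count of `h` as a difference of primes `≤ N`). [folklore] -/
def diffCount (N h : ℕ) : ℕ := #{q ∈ Nat.primesLE N | (q + h).Prime ∧ q + h ≤ N}

/-- A positive pair count exhibits `h = p − q`. [folklore] -/
private theorem exists_of_diffCount_pos {N h : ℕ} (hpos : 0 < diffCount N h) :
    ∃ p q : ℕ, p.Prime ∧ q.Prime ∧ p ≤ N ∧ q + h = p := by
  obtain ⟨q, hq⟩ := Finset.card_pos.mp hpos
  rw [mem_filter, Nat.mem_primesLE] at hq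
  exact ⟨q + h, q, hq.2.1, hq.1.2, hq.2.2, rfl⟩

/-- `R_N(h) ≤ #{p ≤ N prime : p + h prime}` (drop `p + h ≤ N`). [folklore] -/
private theorem diffCount_le_pairFilter (N h : ℕ) :
    diffCount N h ≤ #{q ∈ Nat.primesLE N | (q + h).Prime} :=
  card_le_card fun q hq => by
    rw [mem_filter] at hq ⊢
    exact ⟨hq.1, hq.2.1⟩

/-- `π(N)·(π(N) − 1) ≤ 2·Σ_{1 ≤ h ≤ N} R_N(h)`: the ordered prime pairs `q < p ≤ N` inject into
`{(h, q)}` via `(q, p) ↦ (p − q, q)`. [folklore] -/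
private theorem primeCounting_mul_le_two_mul_sum_diffCount (N : ℕ) :
    Nat.primeCounting N * (Nat.primeCounting N - 1) ≤ 2 * ∑ h ∈ Icc 1 N, diffCount N h := by
  set S := Nat.primesLE N with hS
  have hcardS : #S = Nat.primeCounting N := Nat.primesLE_card_eq_primeCounting N
  set T := S.offDiag.filter (fun z : ℕ × ℕ => z.1 < z.2) with hT
  set T' := S.offDiag.filter (fun z : ℕ × ℕ => ¬ z.1 < z.2) with hT'
  have hTT' : #T + #T' = #S * #S - #S := by
    rw [hT, hT', card_filter_add_card_filter_not, offDiag_card]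
  have hT'le : #T' ≤ #T := by
    have hsub : T' ⊆ T.image Prod.swap := by
      intro z hz
      rw [hT', mem_filter, mem_offDiag] at hz
      rw [mem_image]
      refine ⟨z.swap, ?_, Prod.swap_swap z⟩
      rw [hT, mem_filter, mem_offDiag]
      simp only [Prod.fst_swap, Prod.snd_swap]
      exact ⟨⟨hz.1.2.1, hz.1.1, fun h => hz.1.2.2 h.symm⟩,
        lt_of_le_of_ne (not_lt.mp hz.2) (fun h => hz.1.2.2 h.symm)⟩
    exact (card_le_card hsub).trans card_image_le
  have hinj : #T ≤ ∑ h ∈ Icc 1 N, diffCount N h := by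
    have hsig : ∑ h ∈ Icc 1 N, diffCount N h
        = #((Icc 1 N).sigma fun h => {q ∈ Nat.primesLE N | (q + h).Prime ∧ q + h ≤ N}) := by
      rw [card_sigma]; rfl
    rw [hsig]
    refine card_le_card_of_injOn (fun z : ℕ × ℕ => (⟨z.2 - z.1, z.1⟩ : Σ _ : ℕ, ℕ)) ?_ ?_
    · intro z hz
      rw [mem_coe, hT, mem_filter, mem_offDiag, hS, Nat.mem_primesLE, Nat.mem_primesLE] at hz
      obtain ⟨⟨⟨hq1, hq2⟩, ⟨hp1, hp2⟩, -⟩, hlt⟩ := hz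
      simp only [mem_coe, mem_sigma, mem_Icc, mem_filter, Nat.mem_primesLE]
      refine ⟨⟨by omega, by omega⟩, ⟨hq1, hq2⟩, ?_, by omega⟩
      rw [show z.1 + (z.2 - z.1) = z.2 by omega]
      exact hp2
    · intro z₁ hz₁ z₂ hz₂ heq
      rw [mem_coe, hT, mem_filter] at hz₁ hz₂
      simp only [Sigma.mk.inj_iff, heq_eq_eq] at heq
      have h2 : z₁.2 = z₂.2 := by omega
      exact Prod.ext heq.2 h2
  rw [← hcardS]
  have hsq : #S ≤ #S * #S := Nat.le_mul_self _
  have : #S * (#S - 1) = #S * #S - #S := by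
    rw [Nat.mul_sub_one]
  omega

/-- For odd `h`, `R_N(h) ≤ [h + 2 prime ∧ h + 2 ≤ N]` (the smaller prime must be `2`). [folklore] -/
private theorem diffCount_le_of_odd {N h : ℕ} (hodd : Odd h) :
    diffCount N h ≤ if ((h + 2).Prime ∧ h + 2 ≤ N) then 1 else 0 := by
  unfold diffCount
  have hsub : {q ∈ Nat.primesLE N | (q + h).Prime ∧ q + h ≤ N}
      ⊆ ({2} : Finset ℕ).filter (fun q => (q + h).Prime ∧ q + h ≤ N) := by
    intro q hq
    rw [mem_filter, Nat.mem_primesLE] at hq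
    rw [mem_filter, mem_singleton]
    refine ⟨?_, hq.2⟩
    by_contra hq2
    have hqodd : Odd q := hq.1.2.odd_of_ne_two hq2
    have heven : Even (q + h) := Odd.add_odd hqodd hodd
    have h2 : q + h = 2 := (hq.2.1.even_iff).mp heven
    have := hq.1.2.two_le
    have := hodd.pos
    omega
  refine (card_le_card hsub).trans ?_
  split_ifs with hc
  · exact (card_filter_le _ _).trans (by simp)
  · rw [Nat.le_zero, Finset.card_eq_zero, filter_eq_empty_iff]
    intro q hq
    rw [mem_singleton] at hq
    subst hq
    rwa [add_comm] at hc

/-- `Σ_{odd h ≤ N} R_N(h) ≤ π(N)` (inject `h ↦ h + 2` into the primes `≤ N`). [folklore] -/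
private theorem sum_odd_diffCount_le (N : ℕ) :
    ∑ h ∈ (Icc 1 N).filter Odd, diffCount N h ≤ Nat.primeCounting N := by
  calc ∑ h ∈ (Icc 1 N).filter Odd, diffCount N h
      ≤ ∑ h ∈ (Icc 1 N).filter Odd, (if ((h + 2).Prime ∧ h + 2 ≤ N) then 1 else 0) :=
        sum_le_sum fun h hh => diffCount_le_of_odd (mem_filter.mp hh).2
    _ = #(((Icc 1 N).filter Odd).filter fun h => (h + 2).Prime ∧ h + 2 ≤ N) := by
        rw [card_filter]
    _ ≤ #(Nat.primesLE N) := by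
        refine card_le_card_of_injOn (fun h => h + 2) ?_ ?_
        · intro h hh
          rw [mem_coe, mem_filter] at hh
          rw [mem_coe, Nat.mem_primesLE]
          exact ⟨hh.2.2, hh.2.1⟩
        · intro a _ b _ hab
          simpa using hab
    _ = Nat.primeCounting N := Nat.primesLE_card_eq_primeCounting N

/-- The even first moment: `(π(N)² − 3π(N))/2 ≤ Σ_{even h ≤ N} R_N(h)`. [cite: Nathanson1996, Lemma 7.6 (first moment of r(N); difference analogue with the exact pair injection, proved here)] -/
theorem sum_even_diffCount_ge (N : ℕ) :
    ((Nat.primeCounting N : ℝ) ^ 2 - 3 * Nat.primeCounting N) / 2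
      ≤ ((∑ h ∈ (Icc 1 N).filter Even, diffCount N h : ℕ) : ℝ) := by
  have hsplit : ∑ h ∈ Icc 1 N, diffCount N h
      = ∑ h ∈ (Icc 1 N).filter Even, diffCount N h + ∑ h ∈ (Icc 1 N).filter Odd, diffCount N h := by
    rw [← sum_filter_add_sum_filter_not (Icc 1 N) Even]
    congr 1
    refine sum_congr ?_ fun _ _ => rfl
    ext h
    simp only [mem_filter, Nat.not_even_iff_odd]
  have h1 := primeCounting_mul_le_two_mul_sum_diffCount N
  have h2 := sum_odd_diffCount_le N
  set P := Nat.primeCounting N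
  set SE := ∑ h ∈ (Icc 1 N).filter Even, diffCount N h
  set SO := ∑ h ∈ (Icc 1 N).filter Odd, diffCount N h
  rw [hsplit] at h1
  -- `P (P - 1) ≤ 2 (SE + SO)`, `SO ≤ P` in `ℕ`; pass to `ℝ`
  have h1' : (P : ℝ) * ((P : ℝ) - 1) ≤ 2 * ((SE : ℝ) + SO) := by
    rcases Nat.eq_zero_or_pos P with hP | hP
    · simp [hP]; positivity
    · have : ((P * (P - 1) : ℕ) : ℝ) ≤ ((2 * (SE + SO) : ℕ) : ℝ) := by exact_mod_cast h1
      push_cast [Nat.cast_sub (show 1 ≤ P from hP)] at this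
      linarith
  have h2' : (SO : ℝ) ≤ P := by exact_mod_cast h2
  nlinarith

/-! ## §2 The Hölder count (parametric in the Chebyshev constant `c₀` and the pair-sieve constant `A`) -/

/-- `(Σ_T u)² ≤ |T|·Σ_T u²`. [folklore] -/
private theorem sq_sum_le_card_mul_sum_sq (T : Finset ℕ) (u : ℕ → ℝ) :
    (∑ n ∈ T, u n) ^ 2 ≤ (#T : ℝ) * ∑ n ∈ T, u n ^ 2 := by
  have h := sum_mul_sq_le_sq_mul_sq T u (fun _ => (1 : ℝ))
  simp only [mul_one, one_pow, sum_const, nsmul_eq_mul] at h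
  linarith

/-- Hölder, exponent 8: `(Σ_T u)⁸ ≤ |T|⁷·Σ_T u⁸` for `u ≥ 0` (three Cauchy–Schwarz steps; verbatim the
tree's private `ShnirelmanGoldbachExplicit.pow8_sum_le`). [folklore] -/
private theorem pow8_sum_le (T : Finset ℕ) (u : ℕ → ℝ) (hu : ∀ n ∈ T, 0 ≤ u n) :
    (∑ n ∈ T, u n) ^ 8 ≤ (#T : ℝ) ^ 7 * ∑ n ∈ T, u n ^ 8 := by
  set m : ℝ := (#T : ℝ) with hm
  have hm0 : 0 ≤ m := by positivity
  have hS1 : 0 ≤ ∑ n ∈ T, u n := sum_nonneg hu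
  have hS2 : 0 ≤ ∑ n ∈ T, u n ^ 2 := sum_nonneg fun n _ => by positivity
  have hS4 : 0 ≤ ∑ n ∈ T, u n ^ 4 := sum_nonneg fun n _ => by positivity
  have h1 : (∑ n ∈ T, u n) ^ 2 ≤ m * ∑ n ∈ T, u n ^ 2 := sq_sum_le_card_mul_sum_sq T u
  have h2 : (∑ n ∈ T, u n ^ 2) ^ 2 ≤ m * ∑ n ∈ T, u n ^ 4 := by
    have h := sq_sum_le_card_mul_sum_sq T (fun n => u n ^ 2)
    have e : ∑ n ∈ T, (u n ^ 2) ^ 2 = ∑ n ∈ T, u n ^ 4 := sum_congr rfl fun n _ => by ring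
    rw [e] at h
    exact h
  have h3 : (∑ n ∈ T, u n ^ 4) ^ 2 ≤ m * ∑ n ∈ T, u n ^ 8 := by
    have h := sq_sum_le_card_mul_sum_sq T (fun n => u n ^ 4)
    have e : ∑ n ∈ T, (u n ^ 4) ^ 2 = ∑ n ∈ T, u n ^ 8 := sum_congr rfl fun n _ => by ring
    rw [e] at h
    exact h
  have h1' : ((∑ n ∈ T, u n) ^ 2) ^ 4 ≤ (m * ∑ n ∈ T, u n ^ 2) ^ 4 :=
    pow_le_pow_left₀ (sq_nonneg _) h1 4
  have h2' : (∑ n ∈ T, u n ^ 2) ^ 4 ≤ (m * ∑ n ∈ T, u n ^ 4) ^ 2 := by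
    have := pow_le_pow_left₀ (sq_nonneg _) h2 2
    calc (∑ n ∈ T, u n ^ 2) ^ 4 = ((∑ n ∈ T, u n ^ 2) ^ 2) ^ 2 := by ring
      _ ≤ _ := this
  calc (∑ n ∈ T, u n) ^ 8 = ((∑ n ∈ T, u n) ^ 2) ^ 4 := by ring
    _ ≤ (m * ∑ n ∈ T, u n ^ 2) ^ 4 := h1'
    _ = m ^ 4 * (∑ n ∈ T, u n ^ 2) ^ 4 := by ring
    _ ≤ m ^ 4 * (m * ∑ n ∈ T, u n ^ 4) ^ 2 := mul_le_mul_of_nonneg_left h2' (by positivity)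
    _ = m ^ 6 * (∑ n ∈ T, u n ^ 4) ^ 2 := by ring
    _ ≤ m ^ 6 * (m * ∑ n ∈ T, u n ^ 8) := mul_le_mul_of_nonneg_left h3 (by positivity)
    _ = m ^ 7 * ∑ n ∈ T, u n ^ 8 := by ring

/-- `2.718281828 ≤ e`, hence `e³⁸ ≥ 10¹⁶` and `e²⁰ ≥ 4.8·10⁸`. [folklore] -/
private theorem exp_38_ge : (1e16 : ℝ) ≤ Real.exp 38 := by
  have he : (2.718281828 : ℝ) ≤ Real.exp 1 := by have := Real.exp_one_gt_d9; linarith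
  have h := pow_le_pow_left₀ (by norm_num) he 38
  rw [← Real.exp_nat_mul] at h
  norm_num at h
  linarith

/-- `e²⁰ ≥ 4.8·10⁸`. [folklore] -/
private theorem exp_20_ge : (4.8e8 : ℝ) ≤ Real.exp 20 := by
  have he : (2.718281828 : ℝ) ≤ Real.exp 1 := by have := Real.exp_one_gt_d9; linarith
  have h := pow_le_pow_left₀ (by norm_num) he 20
  rw [← Real.exp_nat_mul] at h
  norm_num at h
  linarith

/-- `log x ≤ 19 + x/e²⁰` for `x > 0` (`log(x/e²⁰) ≤ x/e²⁰ − 1`). [folklore] -/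
private theorem log_le_19_add (x : ℝ) (hx : 0 < x) : Real.log x ≤ 19 + x / Real.exp 20 := by
  have h := Real.log_le_sub_one_of_pos (show 0 < x / Real.exp 20 by positivity)
  rw [Real.log_div hx.ne' (Real.exp_pos 20).ne', Real.log_exp] at h
  linarith

/-- For `N ≥ e³⁸`: `1.5·log N ≤ 10⁻⁴·N`. [folklore] -/
private theorem log_small {N : ℝ} (hN : Real.exp 38 ≤ N) : 1.5 * Real.log N ≤ 1e-4 * N := by
  have hN0 : 0 < N := (Real.exp_pos 38).trans_le hN
  have h1 := log_le_19_add N hN0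
  have h2 : N / Real.exp 20 ≤ N / 4.8e8 := div_le_div_of_nonneg_left hN0.le (by norm_num) exp_20_ge
  have h3 : (1e16 : ℝ) ≤ N := exp_38_ge.trans hN
  linarith

/-- **The Hölder count, general moment.**  If `π(n) ≥ c₀ n/log n` (`n ≥ x₁`, `0.9 ≤ c₀ ≤ 1`), the pair
sieve `#{p ≤ N : p + h prime} ≤ A f(h) N/log²N` holds for even `h ≠ 0` and `N ≥ e^Λ` (`Λ ≥ 38`, `e^Λ ≥ x₁`,
`1 ≤ A ≤ 100`), the moment `Σ_{even n ≤ x} f(n)^{m+1} ≤ C·x` and Hölder `(Σ_T u)^{m+1} ≤ |T|^m Σ_T u^{m+1}`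
are supplied, and `C·κ^m < (c₀²/(2A) − 10⁻⁴)^{m+1}`, then for `N ≥ e^Λ` at least `κ·N` even `h ∈ [1, N]`
are differences `p − q` of primes `q < p ≤ N`. [cite: Nathanson1996, Thm 7.8 (positive density of Goldbach numbers: first moment + pair-sieve cap + Cauchy–Schwarz; difference analogue with a general Hölder exponent, explicit, proved here)] -/
theorem even_count_ge_of_moment (m : ℕ) {C c₀ A Λ κ : ℝ} {x₁ : ℕ} (hc₀ : 0.9 ≤ c₀) (hc₁ : c₀ ≤ 1)
    (hA : 1 ≤ A) (hA' : A ≤ 100) (hΛ : 38 ≤ Λ) (hx₁ : (x₁ : ℝ) ≤ Real.exp Λ)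
    (hπ : PrimeCountingLowerMul c₀ x₁)
    (hpair : ∀ N h : ℕ, Real.exp Λ ≤ N → h ≠ 0 → Even h →
      ((#{q ∈ Nat.primesLE N | (q + h).Prime} : ℕ) : ℝ)
        ≤ A * oddSingularFactor h * (N : ℝ) / Real.log (N : ℝ) ^ 2)
    (hmoment : ∀ x : ℕ, ∑ n ∈ (Ioc 0 x).filter Even, oddSingularFactor n ^ (m + 1) ≤ C * (x : ℝ))
    (hHolder : ∀ (T : Finset ℕ) (u : ℕ → ℝ), (∀ n ∈ T, 0 ≤ u n) →
      (∑ n ∈ T, u n) ^ (m + 1) ≤ (#T : ℝ) ^ m * ∑ n ∈ T, u n ^ (m + 1))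
    (hκ0 : 0 ≤ κ) (hκ : C * κ ^ m < (c₀ ^ 2 / (2 * A) - 1e-4) ^ (m + 1))
    {N : ℕ} (hN : Real.exp Λ ≤ N) :
    κ * N ≤ ((#{h ∈ Icc 1 N | Even h ∧ ∃ p q : ℕ, p.Prime ∧ q.Prime ∧ p ≤ N ∧ q + h = p} : ℕ) : ℝ) := by
  have h38 : Real.exp 38 ≤ N := (Real.exp_le_exp.mpr hΛ).trans hN
  have hN0 : (0 : ℝ) < N := (Real.exp_pos 38).trans_le h38
  have hN16 : (1e16 : ℝ) ≤ N := exp_38_ge.trans h38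
  have hNx₁ : x₁ ≤ N := by exact_mod_cast hx₁.trans hN
  set L : ℝ := Real.log N with hL
  have hL38 : 38 ≤ L := by
    rw [hL, Real.le_log_iff_exp_le hN0]; exact h38
  have hL0 : 0 < L := by linarith
  have hlogsmall : 1.5 * L ≤ 1e-4 * N := log_small h38
  have hA0 : 0 < A := by linarith
  -- the support of `R_N` among even `h`
  set E : Finset ℕ := {h ∈ Icc 1 N | Even h ∧ 0 < diffCount N h} with hE
  have hEsub : E ⊆ {h ∈ Icc 1 N | Even h ∧ ∃ p q : ℕ, p.Prime ∧ q.Prime ∧ p ≤ N ∧ q + h = p} := by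
    intro h hh
    rw [hE, mem_filter] at hh
    rw [mem_filter]
    exact ⟨hh.1, hh.2.1, exists_of_diffCount_pos hh.2.2⟩
  have hcardE : (#E : ℝ)
      ≤ ((#{h ∈ Icc 1 N | Even h ∧ ∃ p q : ℕ, p.Prime ∧ q.Prime ∧ p ≤ N ∧ q + h = p} : ℕ) : ℝ) := by
    exact_mod_cast card_le_card hEsub
  refine le_trans ?_ hcardE
  -- (1) `Σ_{even h} R_N(h) = Σ_E R_N(h) ≤ (A N/L²) Σ_E f`
  set P : ℝ := (Nat.primeCounting N : ℝ) with hP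
  have hmom : (P ^ 2 - 3 * P) / 2 ≤ ((∑ h ∈ (Icc 1 N).filter Even, diffCount N h : ℕ) : ℝ) :=
    sum_even_diffCount_ge N
  have hsuppE : ∑ h ∈ (Icc 1 N).filter Even, diffCount N h = ∑ h ∈ E, diffCount N h := by
    have hEsub' : E ⊆ (Icc 1 N).filter Even := by
      intro h hh
      rw [hE, mem_filter] at hh
      rw [mem_filter]
      exact ⟨hh.1, hh.2.1⟩
    symm
    refine sum_subset hEsub' fun h hh hnot => ?_
    rw [mem_filter] at hh
    by_contra hne
    apply hnot
    rw [hE, mem_filter]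
    exact ⟨hh.1, hh.2, Nat.pos_of_ne_zero hne⟩
  have hcap : ∀ h ∈ E, (diffCount N h : ℝ) ≤ A * (N : ℝ) / L ^ 2 * oddSingularFactor h := by
    intro h hh
    rw [hE, mem_filter, mem_Icc] at hh
    have hh0 : h ≠ 0 := by omega
    have := hpair N h hN hh0 hh.2.1
    calc (diffCount N h : ℝ) ≤ ((#{q ∈ Nat.primesLE N | (q + h).Prime} : ℕ) : ℝ) := by
          exact_mod_cast diffCount_le_pairFilter N h
      _ ≤ A * oddSingularFactor h * (N : ℝ) / Real.log (N : ℝ) ^ 2 := this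
      _ = A * (N : ℝ) / L ^ 2 * oddSingularFactor h := by rw [hL]; ring
  set Sf : ℝ := ∑ h ∈ E, oddSingularFactor h with hSf
  have hSf0 : 0 ≤ Sf := sum_nonneg fun h _ => oddSingularFactor_nonneg h
  have hSf : (P ^ 2 - 3 * P) / 2 ≤ A * (N : ℝ) / L ^ 2 * Sf := by
    calc (P ^ 2 - 3 * P) / 2 ≤ ((∑ h ∈ (Icc 1 N).filter Even, diffCount N h : ℕ) : ℝ) := hmom
      _ = ∑ h ∈ E, (diffCount N h : ℝ) := by rw [hsuppE]; push_cast; rfl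
      _ ≤ ∑ h ∈ E, A * (N : ℝ) / L ^ 2 * oddSingularFactor h := sum_le_sum hcap
      _ = A * (N : ℝ) / L ^ 2 * Sf := by rw [hSf, mul_sum]
  -- (2) `P ≥ c₀ N/L ≥ 1.5`, so `P² − 3P ≥ (c₀N/L)² − 3 c₀N/L`, i.e. `c₀²N² − 3c₀NL ≤ 2AN·Sf`
  have hPge : c₀ * N / L ≤ P := by rw [hP, hL]; exact hπ N hNx₁
  have hNL : L ≤ N := by nlinarith
  have ha : 1.5 ≤ c₀ * N / L := by
    rw [le_div_iff₀ hL0]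
    nlinarith
  have hP2 : (c₀ * N / L) ^ 2 - 3 * (c₀ * N / L) ≤ P ^ 2 - 3 * P := by nlinarith
  have star : c₀ ^ 2 * N ^ 2 - 3 * c₀ * N * L ≤ 2 * A * N * Sf := by
    have h1 : (c₀ * N / L) ^ 2 - 3 * (c₀ * N / L) ≤ 2 * (A * (N : ℝ) / L ^ 2 * Sf) := by linarith
    have h2 := mul_le_mul_of_nonneg_left h1 (sq_nonneg L)
    have e1 : L ^ 2 * ((c₀ * N / L) ^ 2 - 3 * (c₀ * N / L)) = c₀ ^ 2 * N ^ 2 - 3 * c₀ * N * L := by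
      field_simp; try ring
    have e2 : L ^ 2 * (2 * (A * (N : ℝ) / L ^ 2 * Sf)) = 2 * A * N * Sf := by
      field_simp; try ring
    rw [e1, e2] at h2
    exact h2
  -- (3) `Sf ≥ μN`, `μ = c₀²/(2A) − 10⁻⁴`
  set μ : ℝ := c₀ ^ 2 / (2 * A) - 1e-4 with hμ
  have hμpos : 0 < μ := by
    rw [hμ, sub_pos, lt_div_iff₀ (by positivity)]
    nlinarith
  have hμN : μ * N ≤ Sf := by
    have h3 : 3 * c₀ * N * L ≤ 2e-4 * A * N ^ 2 := by
      have h31 : 3 * c₀ * N * L ≤ 3 * N * L := by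
        have h0 : (0 : ℝ) ≤ N * L := mul_nonneg hN0.le hL0.le
        have := mul_le_mul_of_nonneg_left hc₁ (by positivity : (0 : ℝ) ≤ 3 * (N * L))
        linarith
      have h32 : 3 * N * L ≤ 2e-4 * N ^ 2 := by
        have := mul_le_mul_of_nonneg_left hlogsmall (by positivity : (0 : ℝ) ≤ 2 * N)
        linarith
      have h33 : 2e-4 * N ^ 2 ≤ 2e-4 * A * N ^ 2 := by
        have := mul_le_mul_of_nonneg_left hA (by positivity : (0 : ℝ) ≤ 2e-4 * N ^ 2)
        linarith
      linarith
    have h4 : 2 * A * N * (μ * N) ≤ 2 * A * N * Sf := by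
      have e : 2 * A * N * (μ * N) = c₀ ^ 2 * N ^ 2 - 2e-4 * A * N ^ 2 := by
        rw [hμ]; field_simp; try ring
      rw [e]; linarith
    exact le_of_mul_le_mul_left h4 (by positivity)
  -- (4) Hölder with the supplied moment
  have hH := hHolder E (fun h => oddSingularFactor h) fun h _ => oddSingularFactor_nonneg h
  have hCN : ∑ h ∈ E, oddSingularFactor h ^ (m + 1) ≤ C * (N : ℝ) := by
    have hsub : E ⊆ (Ioc 0 N).filter Even := by
      intro h hh
      rw [hE, mem_filter, mem_Icc] at hh
      rw [mem_filter, mem_Ioc]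
      exact ⟨⟨by omega, hh.1.2⟩, hh.2.1⟩
    exact (sum_le_sum_of_subset_of_nonneg hsub fun h _ _ =>
      pow_nonneg (oddSingularFactor_nonneg h) _).trans (hmoment N)
  -- (5) conclude
  by_contra hlt
  push Not at hlt
  have hEm : (#E : ℝ) ^ m ≤ (κ * N) ^ m := pow_le_pow_left₀ (Nat.cast_nonneg _) hlt.le m
  have hchain : (μ * N) ^ (m + 1) ≤ (κ * N) ^ m * (C * N) := by
    calc (μ * N) ^ (m + 1) ≤ Sf ^ (m + 1) := pow_le_pow_left₀ (by positivity) hμN (m + 1)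
      _ ≤ (#E : ℝ) ^ m * ∑ h ∈ E, oddSingularFactor h ^ (m + 1) := hH
      _ ≤ (κ * N) ^ m * (C * N) :=
          mul_le_mul hEm hCN (sum_nonneg fun h _ => pow_nonneg (oddSingularFactor_nonneg h) _)
            (by positivity)
  have hNm : (0 : ℝ) < (N : ℝ) ^ (m + 1) := by positivity
  have : μ ^ (m + 1) * (N : ℝ) ^ (m + 1) ≤ C * κ ^ m * (N : ℝ) ^ (m + 1) := by
    calc μ ^ (m + 1) * (N : ℝ) ^ (m + 1) = (μ * N) ^ (m + 1) := by rw [mul_pow]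
      _ ≤ (κ * N) ^ m * (C * N) := hchain
      _ = C * κ ^ m * (N : ℝ) ^ (m + 1) := by rw [mul_pow, pow_succ]; ring
  have hμm : μ ^ (m + 1) ≤ C * κ ^ m := le_of_mul_le_mul_right this hNm
  exact absurd (lt_of_le_of_lt hμm hκ) (lt_irrefl _)

/-- **The Hölder-8 count** (tree moment `Σ_{even ≤ x} f⁸ ≤ 259.55 x`): `259.55·κ⁷ < (c₀²/(2A) − 10⁻⁴)⁸`
suffices. [cite: Nathanson1996, Thm 7.8 (difference analogue, Hölder-8, explicit; proved here)] -/
theorem even_count_ge_of {c₀ A Λ κ : ℝ} {x₁ : ℕ} (hc₀ : 0.9 ≤ c₀) (hc₁ : c₀ ≤ 1) (hA : 1 ≤ A)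
    (hA' : A ≤ 100) (hΛ : 38 ≤ Λ) (hx₁ : (x₁ : ℝ) ≤ Real.exp Λ) (hπ : PrimeCountingLowerMul c₀ x₁)
    (hpair : ∀ N h : ℕ, Real.exp Λ ≤ N → h ≠ 0 → Even h →
      ((#{q ∈ Nat.primesLE N | (q + h).Prime} : ℕ) : ℝ)
        ≤ A * oddSingularFactor h * (N : ℝ) / Real.log (N : ℝ) ^ 2)
    (hκ0 : 0 ≤ κ) (hκ : 259.55 * κ ^ 7 < (c₀ ^ 2 / (2 * A) - 1e-4) ^ 8)
    {N : ℕ} (hN : Real.exp Λ ≤ N) :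
    κ * N ≤ ((#{h ∈ Icc 1 N | Even h ∧ ∃ p q : ℕ, p.Prime ∧ q.Prime ∧ p ≤ N ∧ q + h = p} : ℕ) : ℝ) :=
  even_count_ge_of_moment 7 hc₀ hc₁ hA hA' hΛ hx₁ hπ hpair sum_even_oddSingularFactor_pow8_le
    pow8_sum_le hκ0 hκ hN

/-! ## §3 Shifted primes: `D(N) ⊇ (P − 3) ∪ (P − 5) ∪ (P − 7)` with Bonferroni -/

/-- `f(2) = 1`. [folklore] -/
private theorem oddSingularFactor_two : oddSingularFactor 2 = 1 := by
  rw [show (2 : ℕ) = 2 ^ 1 * 1 by norm_num, oddSingularFactor_two_pow_mul 1 one_ne_zero,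
    oddSingularFactor_one]

/-- `f(4) = 1`. [folklore] -/
private theorem oddSingularFactor_four : oddSingularFactor 4 = 1 := by
  rw [show (4 : ℕ) = 2 ^ 2 * 1 by norm_num, oddSingularFactor_two_pow_mul 2 one_ne_zero,
    oddSingularFactor_one]

/-- The even differences `h ∈ [1, N]`, `h = p − q`, `p, q ≤ N` primes (even Maillet numbers of level `N`). [cite: Pintz2013Polignac, §1 (differences of primes / Maillet's question); finite-level set defined here] -/
noncomputable abbrev evenDiffSet (N : ℕ) : Finset ℕ :=
  {h ∈ Icc 1 N | Even h ∧ ∃ p q : ℕ, p.Prime ∧ q.Prime ∧ p ≤ N ∧ q + h = p}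

/-- All differences `h ∈ [1, N]`, `h = p − q`, `p, q ≤ N` primes (Maillet numbers of level `N`). [cite: Pintz2013Polignac, §1; finite-level set defined here] -/
noncomputable abbrev diffSet (N : ℕ) : Finset ℕ :=
  {h ∈ Icc 1 N | ∃ p q : ℕ, p.Prime ∧ q.Prime ∧ p ≤ N ∧ q + h = p}

/-- `D_even(N) ⊆ D(N)`. [folklore] -/
private theorem evenDiffSet_subset_diffSet (N : ℕ) : evenDiffSet N ⊆ diffSet N := by
  intro h hh
  rw [mem_filter] at hh ⊢
  exact ⟨hh.1, hh.2.2⟩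

/-- `P − k = {p − k : k < p ≤ N prime}` (shifted primes). [folklore] -/
noncomputable def shiftImage (N k : ℕ) : Finset ℕ := ((Nat.primesLE N).filter fun p => k < p).image fun p => p - k

/-- `#(P − k) ≥ π(N) − π(k)`. [folklore] -/
private theorem card_shiftImage_ge (N k : ℕ) :
    (Nat.primeCounting N : ℝ) - Nat.primeCounting k ≤ #(shiftImage N k) := by
  have hinj : #(shiftImage N k) = #((Nat.primesLE N).filter fun p => k < p) := by
    unfold shiftImage
    refine card_image_of_injOn ?_
    intro a ha b hb hab
    rw [mem_coe, mem_filter] at ha hb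
    simp only at hab
    omega
  have hsd : #(Nat.primesLE N) ≤ #((Nat.primesLE N).filter fun p => k < p) + #(Nat.primesLE k) := by
    refine (card_le_card_sdiff_add_card (s := Nat.primesLE N) (t := Nat.primesLE k)).trans ?_
    refine Nat.add_le_add_right (card_le_card fun p hp => ?_) _
    rw [mem_sdiff, Nat.mem_primesLE, Nat.mem_primesLE] at hp
    rw [mem_filter, Nat.mem_primesLE]
    refine ⟨hp.1, ?_⟩
    by_contra hle
    exact hp.2 ⟨not_lt.mp hle, hp.1.2⟩
  rw [hinj, ← Nat.primesLE_card_eq_primeCounting N, ← Nat.primesLE_card_eq_primeCounting k]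
  have : ((#(Nat.primesLE N) : ℕ) : ℝ) ≤ ((#((Nat.primesLE N).filter fun p => k < p) + #(Nat.primesLE k) : ℕ) : ℝ) := by
    exact_mod_cast hsd
  push_cast at this
  linarith

/-- For an odd prime `k`, `P − k ⊆` the even differences. [folklore] -/
private theorem shiftImage_subset_evenDiffSet {N k : ℕ} (hk : k.Prime) (hk2 : k ≠ 2) :
    shiftImage N k ⊆ evenDiffSet N := by
  intro h hh
  unfold shiftImage at hh
  rw [mem_image] at hh
  obtain ⟨p, hp, rfl⟩ := hh
  rw [mem_filter, Nat.mem_primesLE] at hp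
  have hkodd : Odd k := hk.odd_of_ne_two hk2
  have hp2 : p ≠ 2 := by have := hk.two_le; omega
  have hpodd : Odd p := hp.1.2.odd_of_ne_two hp2
  rw [mem_filter, mem_Icc]
  exact ⟨⟨by omega, by omega⟩, Nat.Odd.sub_odd hpodd hkodd, p, k, hp.1.2, hk, hp.1.1, by omega⟩

/-- `P − 2 ⊆` all differences (odd ones). [folklore] -/
private theorem shiftImage_two_subset_diffSet (N : ℕ) : shiftImage N 2 ⊆ diffSet N := by
  intro h hh
  unfold shiftImage at hh
  rw [mem_image] at hh
  obtain ⟨p, hp, rfl⟩ := hh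
  rw [mem_filter, Nat.mem_primesLE] at hp
  rw [mem_filter, mem_Icc]
  exact ⟨⟨by omega, by omega⟩, p, 2, hp.1.2, Nat.prime_two, hp.1.1, by omega⟩

/-- `(P − a) ∩ (P − b)` injects (`h ↦ h + a`) into `{q ≤ N prime : q + (b − a) prime}`. [folklore] -/
private theorem card_shiftImage_inter_le {N a b : ℕ} (hab : a ≤ b) :
    #(shiftImage N a ∩ shiftImage N b) ≤ #{q ∈ Nat.primesLE N | (q + (b - a)).Prime} := by
  refine card_le_card_of_injOn (fun h => h + a) ?_ ?_
  · intro h hh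
    rw [mem_coe, mem_inter] at hh
    obtain ⟨ha, hb⟩ := hh
    unfold shiftImage at ha hb
    rw [mem_image] at ha hb
    obtain ⟨p, hp, hph⟩ := ha
    obtain ⟨p', hp', hp'h⟩ := hb
    rw [mem_filter, Nat.mem_primesLE] at hp hp'
    simp only [mem_coe, mem_filter, Nat.mem_primesLE]
    have e1 : h + a = p := by omega
    have e2 : h + a + (b - a) = p' := by omega
    rw [e2, e1]
    exact ⟨⟨hp.1.1, hp.1.2⟩, hp'.1.2⟩
  · intro x _ y _ hxy
    simpa using hxy

/-- Bonferroni for three sets: `#A + #B + #C ≤ #(A ∪ B ∪ C) + #(A ∩ B) + #(A ∩ C) + #(B ∩ C)`. [folklore] -/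
private theorem bonferroni_three (A B C : Finset ℕ) :
    #A + #B + #C ≤ #(A ∪ B ∪ C) + #(A ∩ B) + #(A ∩ C) + #(B ∩ C) := by
  have h1 := card_union_add_card_inter A B
  have h2 := card_union_add_card_inter (A ∪ B) C
  have h3 : #((A ∪ B) ∩ C) ≤ #(A ∩ C) + #(B ∩ C) := by
    rw [union_inter_distrib_right]
    exact card_union_le _ _
  omega

/-- **Three shifts.**  For `N ≥ e³⁸`: `3π(N) − 9 − 39.03·N/log²N ≤ #{even differences ≤ N}`. [folklore] -/
private theorem evenDiffSet_card_ge_three_shifts {N : ℕ} (hN : Real.exp 38 ≤ N) :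
    3 * (Nat.primeCounting N : ℝ) - 9 - 39.03 * N / Real.log N ^ 2 ≤ #(evenDiffSet N) := by
  set A := shiftImage N 3
  set B := shiftImage N 5
  set C := shiftImage N 7
  have hsub : A ∪ B ∪ C ⊆ evenDiffSet N := by
    refine union_subset (union_subset ?_ ?_) ?_
    · exact shiftImage_subset_evenDiffSet Nat.prime_three (by norm_num)
    · exact shiftImage_subset_evenDiffSet (by norm_num) (by norm_num)
    · exact shiftImage_subset_evenDiffSet (by norm_num) (by norm_num)
  have hU : (#(A ∪ B ∪ C) : ℝ) ≤ #(evenDiffSet N) := by exact_mod_cast card_le_card hsub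
  have hbon : ((#A + #B + #C : ℕ) : ℝ) ≤ ((#(A ∪ B ∪ C) + #(A ∩ B) + #(A ∩ C) + #(B ∩ C) : ℕ) : ℝ) := by
    exact_mod_cast bonferroni_three A B C
  push_cast at hbon
  have hA : (Nat.primeCounting N : ℝ) - 2 ≤ #A := by
    have := card_shiftImage_ge N 3
    have e : Nat.primeCounting 3 = 2 := by decide
    rw [e] at this; push_cast at this; exact this
  have hB : (Nat.primeCounting N : ℝ) - 3 ≤ #B := by
    have := card_shiftImage_ge N 5
    have e : Nat.primeCounting 5 = 3 := by decide
    rw [e] at this; push_cast at this; exact this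
  have hC : (Nat.primeCounting N : ℝ) - 4 ≤ #C := by
    have := card_shiftImage_ge N 7
    have e : Nat.primeCounting 7 = 4 := by decide
    rw [e] at this; push_cast at this; exact this
  have hpair : ∀ d : ℕ, d ≠ 0 → Even d → oddSingularFactor d = 1 →
      ((#{q ∈ Nat.primesLE N | (q + d).Prime} : ℕ) : ℝ) ≤ 13.01 * N / Real.log N ^ 2 := by
    intro d hd hev hf
    have := pairCount_le_1301 (N := N) (h := d) hN hd hev
    rw [hf, mul_one] at this
    exact this
  have hAB : (#(A ∩ B) : ℝ) ≤ 13.01 * N / Real.log N ^ 2 := by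
    have h1 : (#(A ∩ B) : ℝ) ≤ ((#{q ∈ Nat.primesLE N | (q + (5 - 3)).Prime} : ℕ) : ℝ) := by
      exact_mod_cast card_shiftImage_inter_le (N := N) (by norm_num : 3 ≤ 5)
    exact h1.trans (hpair 2 two_ne_zero even_two oddSingularFactor_two)
  have hAC : (#(A ∩ C) : ℝ) ≤ 13.01 * N / Real.log N ^ 2 := by
    have h1 : (#(A ∩ C) : ℝ) ≤ ((#{q ∈ Nat.primesLE N | (q + (7 - 3)).Prime} : ℕ) : ℝ) := by
      exact_mod_cast card_shiftImage_inter_le (N := N) (by norm_num : 3 ≤ 7)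
    exact h1.trans (hpair 4 (by norm_num) (by decide) oddSingularFactor_four)
  have hBC : (#(B ∩ C) : ℝ) ≤ 13.01 * N / Real.log N ^ 2 := by
    have h1 : (#(B ∩ C) : ℝ) ≤ ((#{q ∈ Nat.primesLE N | (q + (7 - 5)).Prime} : ℕ) : ℝ) := by
      exact_mod_cast card_shiftImage_inter_le (N := N) (by norm_num : 5 ≤ 7)
    exact h1.trans (hpair 2 two_ne_zero even_two oddSingularFactor_two)
  have e : 39.03 * (N : ℝ) / Real.log N ^ 2 = 3 * (13.01 * N / Real.log N ^ 2) := by ring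
  rw [e]
  linarith

/-- **One shift.**  `π(N) − 2 ≤ #{even differences ≤ N}` for every `N`. [folklore] -/
private theorem evenDiffSet_card_ge_one_shift (N : ℕ) :
    (Nat.primeCounting N : ℝ) - 2 ≤ #(evenDiffSet N) := by
  have h1 := card_shiftImage_ge N 3
  have e : Nat.primeCounting 3 = 2 := by decide
  rw [e] at h1; push_cast at h1
  have h2 : (#(shiftImage N 3) : ℝ) ≤ #(evenDiffSet N) := by
    exact_mod_cast card_le_card (shiftImage_subset_evenDiffSet Nat.prime_three (by norm_num))
  linarith

/-! ## §4 Small `N` -/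

/-- A prime pair `q < p ≤ N` with `p − q` even puts `p − q` into `D_even(N)`. [folklore] -/
private theorem mem_evenDiffSet_of {N p q : ℕ} (hp : p.Prime) (hq : q.Prime) (hpN : p ≤ N) (hqp : q < p)
    (he : Even (p - q)) : p - q ∈ evenDiffSet N := by
  rw [mem_filter, mem_Icc]
  exact ⟨⟨by omega, by omega⟩, he, p, q, hp, hq, hpN, by omega⟩

/-- `N ≥ 13`: `{2,4,6,8,10} ⊆` even differences. [folklore] -/
private theorem five_le_card_evenDiffSet {N : ℕ} (hN : 13 ≤ N) : (5 : ℝ) ≤ #(evenDiffSet N) := by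
  have hsub : ({2, 4, 6, 8, 10} : Finset ℕ) ⊆ evenDiffSet N := by
    intro h hh
    simp only [mem_insert, mem_singleton] at hh
    rcases hh with rfl | rfl | rfl | rfl | rfl
    · exact mem_evenDiffSet_of (p := 5) (q := 3) (by norm_num) (by norm_num) (by omega) (by norm_num)
        (by decide)
    · exact mem_evenDiffSet_of (p := 7) (q := 3) (by norm_num) (by norm_num) (by omega) (by norm_num)
        (by decide)
    · exact mem_evenDiffSet_of (p := 11) (q := 5) (by norm_num) (by norm_num) (by omega) (by norm_num)
        (by decide)
    · exact mem_evenDiffSet_of (p := 11) (q := 3) (by norm_num) (by norm_num) (by omega) (by norm_num)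
        (by decide)
    · exact mem_evenDiffSet_of (p := 13) (q := 3) (by norm_num) (by norm_num) (by omega) (by norm_num)
        (by decide)
  have := card_le_card hsub
  have e : #({2, 4, 6, 8, 10} : Finset ℕ) = 5 := by decide
  rw [e] at this
  exact_mod_cast this

/-- `N ≥ 5`: `2 = 5 − 3` is an even difference. [folklore] -/
private theorem one_le_card_evenDiffSet {N : ℕ} (hN : 5 ≤ N) : (1 : ℝ) ≤ #(evenDiffSet N) := by
  have hmem : 2 ∈ evenDiffSet N :=
    mem_evenDiffSet_of (p := 5) (q := 3) (by norm_num) (by norm_num) (by omega) (by norm_num) (by decide)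
  have : 1 ≤ #(evenDiffSet N) := card_pos.mpr ⟨2, hmem⟩
  exact_mod_cast this

/-- `N ≥ 3`: `1 = 3 − 2` is a difference. [folklore] -/
private theorem one_le_card_diffSet {N : ℕ} (hN : 3 ≤ N) : (1 : ℝ) ≤ #(diffSet N) := by
  have hmem : 1 ∈ diffSet N := by
    rw [mem_filter, mem_Icc]
    exact ⟨⟨le_rfl, by omega⟩, 3, 2, Nat.prime_three, Nat.prime_two, hN, rfl⟩
  have : 1 ≤ #(diffSet N) := card_pos.mpr ⟨1, hmem⟩
  exact_mod_cast this

/-! ## §5 The sixteenth moment `Σ_{even n ≤ x} f(n)¹⁶ ≤ 2.15·10⁶·x` and Hölder-16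

Verbatim the architecture of the tree's §14.1 (`ShnirelmanGoldbachFlatten.lean`: `g8Factor`,
`prod_g8Factor_le`, `sum_even_oddSingularFactor_pow8_le`) with `8 → 16`: head `∏_{2<p≤100}(1 + g₁₆(p)/p)
≤ 3 918 300` (`norm_num`), tail `exp(17.7·Σ_{p ≥ 101 odd} 1/p²) ≤ exp(17.7/198) ≤ 1.0974`. -/

/-- The local factor `g₁₆(p) = ((p−1)/(p−2))¹⁶ − 1`, so that `f(n)¹⁶ = ∏_{p∣n, p>2}(1 + g₁₆(p))`. [folklore] -/
noncomputable def g16Factor (p : ℕ) : ℝ := (((p : ℝ) - 1) / ((p : ℝ) - 2)) ^ 16 - 1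

/-- `f(n)¹⁶ = Σ_{T ⊆ {p ∣ n : p > 2}} ∏_{p ∈ T} g₁₆(p)`. [folklore] -/
private theorem oddSingularFactor_pow16_eq (n : ℕ) :
    oddSingularFactor n ^ 16 = ∑ T ∈ (n.primeFactors.filter (2 < ·)).powerset, ∏ p ∈ T, g16Factor p := by
  unfold oddSingularFactor
  rw [← prod_pow, ← prod_one_add]
  exact prod_congr rfl fun p _ => by unfold g16Factor; ring

/-- `g₁₆(p) ≥ 0` for `p ≥ 3`. [folklore] -/
private theorem g16Factor_nonneg {p : ℕ} (hp : 2 < p) : 0 ≤ g16Factor p := by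
  unfold g16Factor
  have hp3 : (3 : ℝ) ≤ p := by exact_mod_cast hp
  have h1 : 1 ≤ ((p : ℝ) - 1) / ((p : ℝ) - 2) := by
    rw [le_div_iff₀ (by linarith)]; linarith
  have h16 : (1 : ℝ) ≤ (((p : ℝ) - 1) / ((p : ℝ) - 2)) ^ 16 := one_le_pow₀ h1
  linarith

/-- `((t+1)¹⁶ − t¹⁶)(t+2) ≤ 17.7·t¹⁶` for `t ≥ 99`. [folklore] -/
private theorem poly16_le {t : ℝ} (ht : 99 ≤ t) : ((t + 1) ^ 16 - t ^ 16) * (t + 2) ≤ 17.7 * t ^ 16 := by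
  have ht0 : 0 ≤ t := by linarith
  have h0 : 0 ≤ t - 99 := by linarith
  have h1 : 99 * t ≤ t ^ 2 := by nlinarith
  have h2 : 99 * t ^ 2 ≤ t ^ 3 := by nlinarith [mul_nonneg (pow_nonneg ht0 2) h0]
  have h3 : 99 * t ^ 3 ≤ t ^ 4 := by nlinarith [mul_nonneg (pow_nonneg ht0 3) h0]
  have h4 : 99 * t ^ 4 ≤ t ^ 5 := by nlinarith [mul_nonneg (pow_nonneg ht0 4) h0]
  have h5 : 99 * t ^ 5 ≤ t ^ 6 := by nlinarith [mul_nonneg (pow_nonneg ht0 5) h0]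
  have h6 : 99 * t ^ 6 ≤ t ^ 7 := by nlinarith [mul_nonneg (pow_nonneg ht0 6) h0]
  have h7 : 99 * t ^ 7 ≤ t ^ 8 := by nlinarith [mul_nonneg (pow_nonneg ht0 7) h0]
  have h8 : 99 * t ^ 8 ≤ t ^ 9 := by nlinarith [mul_nonneg (pow_nonneg ht0 8) h0]
  have h9 : 99 * t ^ 9 ≤ t ^ 10 := by nlinarith [mul_nonneg (pow_nonneg ht0 9) h0]
  have h10 : 99 * t ^ 10 ≤ t ^ 11 := by nlinarith [mul_nonneg (pow_nonneg ht0 10) h0]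
  have h11 : 99 * t ^ 11 ≤ t ^ 12 := by nlinarith [mul_nonneg (pow_nonneg ht0 11) h0]
  have h12 : 99 * t ^ 12 ≤ t ^ 13 := by nlinarith [mul_nonneg (pow_nonneg ht0 12) h0]
  have h13 : 99 * t ^ 13 ≤ t ^ 14 := by nlinarith [mul_nonneg (pow_nonneg ht0 13) h0]
  have h14 : 99 * t ^ 14 ≤ t ^ 15 := by nlinarith [mul_nonneg (pow_nonneg ht0 14) h0]
  have h15 : 99 * t ^ 15 ≤ t ^ 16 := by nlinarith [mul_nonneg (pow_nonneg ht0 15) h0]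
  linarith [h1, h2, h3, h4, h5, h6, h7, h8, h9, h10, h11, h12, h13, h14, h15, ht0]

/-- For `p ≥ 101`: `g₁₆(p)/p ≤ 17.7/p²`. [folklore] -/
private theorem g16Factor_div_le {p : ℕ} (hp : 101 ≤ p) : g16Factor p / p ≤ 17.7 / (p : ℝ) ^ 2 := by
  unfold g16Factor
  have hp' : (101 : ℝ) ≤ p := by exact_mod_cast hp
  set t : ℝ := (p : ℝ) - 2 with ht
  have ht99 : 99 ≤ t := by linarith
  have ht0 : 0 < t := by linarith
  have hp1 : (p : ℝ) - 1 = t + 1 := by linarith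
  have hpt : (p : ℝ) = t + 2 := by linarith
  rw [hp1, hpt]
  have hg : ((t + 1) / t) ^ 16 - 1 = ((t + 1) ^ 16 - t ^ 16) / t ^ 16 := by
    rw [div_pow]
    field_simp
  rw [hg, div_div, div_le_div_iff₀ (by positivity) (by positivity)]
  have hpoly := poly16_le ht99
  have ht16 : 0 < t ^ 16 := by positivity
  have ht2 : 0 < t + 2 := by linarith
  nlinarith [mul_le_mul_of_nonneg_right hpoly ht2.le]

/-- `Σ_{p ∈ T} 1/p² ≤ 1/198` for any finite set `T` of odd integers `≥ 101` (verbatim the tree's private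
`ShnirelmanGoldbachExplicit.sum_inv_sq_le_of_odd`). [folklore] -/
private theorem sum_inv_sq_le_of_odd (T : Finset ℕ) (hT : ∀ p ∈ T, Odd p ∧ 101 ≤ p) :
    ∑ p ∈ T, 1 / (p : ℝ) ^ 2 ≤ 1 / 198 := by
  have htel : ∀ M : ℕ, 49 ≤ M →
      ∑ m ∈ Icc 50 M, (1 / (2 * (m : ℝ) - 1) - 1 / (2 * (m : ℝ) + 1)) = 1 / 99 - 1 / (2 * (M : ℝ) + 1) := by
    intro M hM
    induction M with
    | zero => omega
    | succ M ih =>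
        rcases Nat.lt_or_ge M 49 with h | h
        · have hM' : M = 48 := by omega
          subst hM'
          rw [Finset.Icc_eq_empty (by norm_num), sum_empty]
          norm_num
        · rw [sum_Icc_succ_top (by omega), ih h]
          push_cast
          ring
  by_cases hTe : T = ∅
  · rw [hTe, sum_empty]; norm_num
  obtain ⟨p₀, hp₀⟩ := Finset.nonempty_iff_ne_empty.mpr hTe
  obtain ⟨M, hM⟩ : ∃ M : ℕ, T.sup (fun p => (p - 1) / 2) = M := ⟨_, rfl⟩
  have hM49 : 49 ≤ M := by
    have h1 := Finset.le_sup (f := fun p => (p - 1) / 2) hp₀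
    simp only [hM] at h1
    have h2 := (hT p₀ hp₀).2
    omega
  have hsub : T ⊆ (Icc 50 M).image (fun m => 2 * m + 1) := by
    intro p hp
    obtain ⟨⟨k, hk⟩, hp101⟩ := hT p hp
    rw [mem_image]
    refine ⟨k, ?_, hk.symm⟩
    rw [mem_Icc]
    have h1 := Finset.le_sup (f := fun p => (p - 1) / 2) hp
    simp only [hM] at h1
    constructor <;> omega
  have hterm : ∀ p ∈ T, 1 / (p : ℝ) ^ 2 ≤ (1 / 2 : ℝ) * (1 / ((p : ℝ) - 2) - 1 / p) := by
    intro p hp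
    have hp101 : (101 : ℝ) ≤ p := by exact_mod_cast (hT p hp).2
    have hp2 : (p : ℝ) - 2 ≠ 0 := by
      have : (0 : ℝ) < (p : ℝ) - 2 := by linarith
      exact ne_of_gt this
    have hp0 : (p : ℝ) ≠ 0 := by
      have : (0 : ℝ) < (p : ℝ) := by linarith
      exact ne_of_gt this
    have heq : (1 / 2 : ℝ) * (1 / ((p : ℝ) - 2) - 1 / p) = 1 / (((p : ℝ) - 2) * p) := by
      field_simp; ring
    rw [heq]
    exact one_div_le_one_div_of_le (by nlinarith) (by nlinarith)
  have hnonneg : ∀ q : ℕ, q ∈ (Icc 50 M).image (fun m => 2 * m + 1) →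
      0 ≤ (1 / 2 : ℝ) * (1 / ((q : ℝ) - 2) - 1 / q) := by
    intro q hq
    rw [mem_image] at hq
    obtain ⟨m, hm, rfl⟩ := hq
    rw [mem_Icc] at hm
    have hm50 : (50 : ℝ) ≤ m := by exact_mod_cast hm.1
    push_cast
    have h1 : 1 / (2 * (m : ℝ) + 1) ≤ 1 / (2 * (m : ℝ) + 1 - 2) :=
      one_div_le_one_div_of_le (by linarith) (by linarith)
    linarith
  calc ∑ p ∈ T, 1 / (p : ℝ) ^ 2 ≤ ∑ p ∈ T, (1 / 2 : ℝ) * (1 / ((p : ℝ) - 2) - 1 / p) := sum_le_sum hterm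
    _ ≤ ∑ q ∈ (Icc 50 M).image (fun m => (2 * m + 1 : ℕ)), (1 / 2 : ℝ) * (1 / ((q : ℝ) - 2) - 1 / q) :=
        sum_le_sum_of_subset_of_nonneg hsub fun q hq _ => hnonneg q hq
    _ = ∑ m ∈ Icc 50 M, (1 / 2 : ℝ) * (1 / (2 * (m : ℝ) - 1) - 1 / (2 * (m : ℝ) + 1)) := by
        rw [sum_image (fun a _ b _ h => by omega)]
        refine sum_congr rfl fun m _ => ?_
        push_cast
        ring
    _ = (1 / 2 : ℝ) * (1 / 99 - 1 / (2 * (M : ℝ) + 1)) := by rw [← mul_sum, htel M hM49]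
    _ ≤ 1 / 198 := by
        have : (0 : ℝ) ≤ 1 / (2 * (M : ℝ) + 1) := by positivity
        linarith

set_option maxHeartbeats 4000000 in
/-- `∏_{p ∈ O}(1 + g₁₆(p)/p) ≤ 4.3·10⁶` over any finite set of odd primes: head (`p ≤ 100`) `≤ 3 918 300`
(`norm_num`), tail `≤ exp(17.7/198) ≤ 1.0974`. [folklore] -/
private theorem prod_g16Factor_le (O : Finset ℕ) (hO : ∀ p ∈ O, p.Prime ∧ 2 < p) :
    ∏ p ∈ O, (1 + g16Factor p / p) ≤ 4.3e6 := by
  have hF1 : ∀ p : ℕ, 2 < p → 1 ≤ 1 + g16Factor p / p := fun p hp => by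
    have h1 := g16Factor_nonneg hp
    have h2 : (0 : ℝ) ≤ g16Factor p / p := by positivity
    linarith
  have hF0 : ∀ p ∈ O, 0 ≤ 1 + g16Factor p / p := fun p hp => le_trans zero_le_one (hF1 p (hO p hp).2)
  rw [← prod_filter_mul_prod_filter_not O (fun p => p ≤ 100)]
  have hsub : O.filter (fun p => p ≤ 100) ⊆ (range 101).filter (fun p => p.Prime ∧ 2 < p) := by
    intro p hp
    rw [mem_filter] at hp ⊢
    obtain ⟨hpO, hp100⟩ := hp
    exact ⟨mem_range.mpr (by omega), hO p hpO⟩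
  have hhead : ∏ p ∈ O.filter (fun p => p ≤ 100), (1 + g16Factor p / p) ≤ 3918300 := by
    have hUval : ∏ p ∈ (range 101).filter (fun p => p.Prime ∧ 2 < p), (1 + g16Factor p / p)
        ≤ 3918300 := by
      rw [prod_filter]
      simp only [prod_range_succ, prod_range_zero, g16Factor]
      norm_num
    refine le_trans ?_ hUval
    rw [← prod_sdiff hsub]
    have h1 : 1 ≤ ∏ p ∈ (range 101).filter (fun p => p.Prime ∧ 2 < p) \ O.filter (fun p => p ≤ 100),
        (1 + g16Factor p / p) := by
      calc (1 : ℝ) = ∏ p ∈ (range 101).filter (fun p => p.Prime ∧ 2 < p) \ O.filter (fun p => p ≤ 100),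
          (1 : ℝ) := prod_const_one.symm
        _ ≤ _ := prod_le_prod (fun _ _ => zero_le_one) fun p hp =>
          hF1 p (mem_filter.mp (sdiff_subset hp)).2.2
    have h0 : 0 ≤ ∏ p ∈ O.filter (fun p => p ≤ 100), (1 + g16Factor p / p) :=
      prod_nonneg fun p hp => hF0 p (mem_filter.mp hp).1
    exact le_mul_of_one_le_left h0 h1
  have htail : ∏ p ∈ O.filter (fun p => ¬p ≤ 100), (1 + g16Factor p / p) ≤ 1.0974 := by
    set T' := O.filter (fun p => ¬p ≤ 100) with hT'
    have hT'mem : ∀ p ∈ T', p.Prime ∧ 2 < p ∧ 101 ≤ p := fun p hp => by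
      rw [hT', mem_filter] at hp
      exact ⟨(hO p hp.1).1, (hO p hp.1).2, by omega⟩
    have h1 : ∏ p ∈ T', (1 + g16Factor p / p) ≤ Real.exp (∑ p ∈ T', g16Factor p / p) := by
      rw [Real.exp_sum]
      exact prod_le_prod (fun p hp => hF0 p (mem_filter.mp hp).1) fun p _ => by
        have := Real.add_one_le_exp (g16Factor p / p); linarith
    have h2 : ∑ p ∈ T', g16Factor p / p ≤ 17.7 * ∑ p ∈ T', 1 / (p : ℝ) ^ 2 := by
      rw [mul_sum]
      exact sum_le_sum fun p hp => by
        calc g16Factor p / p ≤ 17.7 / (p : ℝ) ^ 2 := g16Factor_div_le (hT'mem p hp).2.2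
          _ = 17.7 * (1 / (p : ℝ) ^ 2) := by ring
    have h3 : ∑ p ∈ T', 1 / (p : ℝ) ^ 2 ≤ 1 / 198 :=
      sum_inv_sq_le_of_odd T' fun p hp =>
        ⟨(hT'mem p hp).1.odd_of_ne_two (by have := (hT'mem p hp).2.1; omega), (hT'mem p hp).2.2⟩
    have h4 : ∑ p ∈ T', g16Factor p / p ≤ 0.0894 := by linarith
    have h5 : Real.exp (∑ p ∈ T', g16Factor p / p) ≤ Real.exp 0.0894 := Real.exp_le_exp.mpr h4
    have h6 : Real.exp (0.0894 : ℝ) ≤ 1.0974 := by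
      have := Real.abs_exp_sub_one_sub_id_le (x := (0.0894 : ℝ)) (by rw [abs_le]; constructor <;> norm_num)
      rw [abs_le] at this
      nlinarith [this.2]
    linarith
  have htail0 : 0 ≤ ∏ p ∈ O.filter (fun p => ¬p ≤ 100), (1 + g16Factor p / p) :=
    prod_nonneg fun p hp => hF0 p (mem_filter.mp hp).1
  calc (∏ p ∈ O.filter (fun p => p ≤ 100), (1 + g16Factor p / p)) *
        ∏ p ∈ O.filter (fun p => ¬p ≤ 100), (1 + g16Factor p / p) ≤ 3918300 * 1.0974 :=
        mul_le_mul hhead htail htail0 (by norm_num)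
    _ ≤ 4.3e6 := by norm_num

/-- `Σ_{even n ∈ (0, x]} f(n)¹⁶ ≤ (x/2)·∏_{2<p≤x}(1 + g₁₆(p)/p)` (expand, swap, count even multiples). [folklore] -/
private theorem sum_even_oddSingularFactor_pow16_le_prod (x : ℕ) :
    ∑ n ∈ (Ioc 0 x).filter Even, oddSingularFactor n ^ 16
      ≤ (x : ℝ) / 2 * ∏ p ∈ (range (x + 1)).filter (fun p => p.Prime ∧ 2 < p), (1 + g16Factor p / p) := by
  set E := (Ioc 0 x).filter Even with hE
  set O := (range (x + 1)).filter (fun p => p.Prime ∧ 2 < p) with hO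
  have hSO : ∀ n ∈ E, n.primeFactors.filter (2 < ·) ⊆ O := by
    intro n hn p hp
    rw [hE, mem_filter, mem_Ioc] at hn
    rw [mem_filter, Nat.mem_primeFactors] at hp
    obtain ⟨⟨hpr, hpd, hn0⟩, hp2⟩ := hp
    rw [hO, mem_filter, mem_range]
    have := Nat.le_of_dvd (by omega) hpd
    exact ⟨by omega, hpr, hp2⟩
  have hg0 : ∀ p ∈ O, 0 ≤ g16Factor p := fun p hp => by
    rw [hO, mem_filter] at hp
    exact g16Factor_nonneg hp.2.2
  have hw0 : ∀ T ∈ O.powerset, 0 ≤ ∏ p ∈ T, g16Factor p := fun T hT =>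
    prod_nonneg fun p hp => hg0 p (mem_powerset.mp hT hp)
  have hexp : ∀ n ∈ E, oddSingularFactor n ^ 16
      = ∑ T ∈ O.powerset, if T ⊆ n.primeFactors.filter (2 < ·) then ∏ p ∈ T, g16Factor p else 0 := by
    intro n hn
    rw [oddSingularFactor_pow16_eq, ← sum_filter]
    apply sum_congr _ (fun _ _ => rfl)
    ext T
    simp only [mem_powerset, mem_filter]
    exact ⟨fun h => ⟨h.trans (hSO n hn), h⟩, fun h => h.2⟩
  have hswap : ∑ n ∈ E, oddSingularFactor n ^ 16
      = ∑ T ∈ O.powerset, (∏ p ∈ T, g16Factor p) * #{n ∈ E | T ⊆ n.primeFactors.filter (2 < ·)} := by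
    rw [sum_congr rfl hexp, sum_comm]
    refine sum_congr rfl fun T _ => ?_
    rw [← sum_filter, sum_const, nsmul_eq_mul, mul_comm]
  have hcount : ∀ T ∈ O.powerset,
      (#{n ∈ E | T ⊆ n.primeFactors.filter (2 < ·)} : ℝ) ≤ (x : ℝ) / (2 * ∏ p ∈ T, (p : ℝ)) := by
    intro T hT
    rw [mem_powerset] at hT
    have hTprime : ∀ p ∈ T, p.Prime ∧ 2 < p := fun p hp => by
      have := hT hp
      rw [hO, mem_filter] at this
      exact this.2
    set d := ∏ p ∈ T, p with hd
    have h2d : Nat.Coprime 2 d := Nat.Coprime.prod_right fun p hp =>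
      (Nat.coprime_primes Nat.prime_two (hTprime p hp).1).mpr (by have := (hTprime p hp).2; omega)
    have hsub : {n ∈ E | T ⊆ n.primeFactors.filter (2 < ·)} ⊆ {n ∈ Ioc 0 x | 2 * d ∣ n} := by
      intro n hn
      rw [mem_filter, hE, mem_filter] at hn
      obtain ⟨⟨hnx, hneven⟩, hTS⟩ := hn
      rw [mem_filter]
      refine ⟨hnx, Nat.Coprime.mul_dvd_of_dvd_of_dvd h2d (even_iff_two_dvd.mp hneven) ?_⟩
      rw [hd]
      exact Finset.prod_primes_dvd n (fun p hp => (hTprime p hp).1.prime) fun p hp => by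
        have := hTS hp
        rw [mem_filter, Nat.mem_primeFactors] at this
        exact this.1.2.1
    have hcard := card_le_card hsub
    rw [Nat.Ioc_filter_dvd_card_eq_div] at hcard
    have hdiv : ((x / (2 * d) : ℕ) : ℝ) ≤ (x : ℝ) / ((2 * d : ℕ) : ℝ) := Nat.cast_div_le
    calc (#{n ∈ E | T ⊆ n.primeFactors.filter (2 < ·)} : ℝ) ≤ ((x / (2 * d) : ℕ) : ℝ) := by
          exact_mod_cast hcard
      _ ≤ (x : ℝ) / ((2 * d : ℕ) : ℝ) := hdiv
      _ = (x : ℝ) / (2 * ∏ p ∈ T, (p : ℝ)) := by rw [hd]; push_cast; rfl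
  calc ∑ n ∈ E, oddSingularFactor n ^ 16
      = ∑ T ∈ O.powerset, (∏ p ∈ T, g16Factor p) * #{n ∈ E | T ⊆ n.primeFactors.filter (2 < ·)} := hswap
    _ ≤ ∑ T ∈ O.powerset, (∏ p ∈ T, g16Factor p) * ((x : ℝ) / (2 * ∏ p ∈ T, (p : ℝ))) :=
        sum_le_sum fun T hT => mul_le_mul_of_nonneg_left (hcount T hT) (hw0 T hT)
    _ = (x : ℝ) / 2 * ∑ T ∈ O.powerset, ∏ p ∈ T, (g16Factor p / p) := by
        rw [mul_sum]
        refine sum_congr rfl fun T hT => ?_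
        rw [prod_div_distrib]
        have hTpos : (0 : ℝ) < ∏ p ∈ T, (p : ℝ) := prod_pos fun p hp => by
          have := (mem_powerset.mp hT) hp
          rw [hO, mem_filter] at this
          exact_mod_cast this.2.1.pos
        field_simp
    _ = (x : ℝ) / 2 * ∏ p ∈ O, (1 + g16Factor p / p) := by rw [prod_one_add]

/-- **Sixteenth moment of the singular factor**: `Σ_{even n ∈ (0, x]} f(n)¹⁶ ≤ 2.15·10⁶·x`.
[cite: Nathanson1996, Lemma 7.7 (explicit sixteenth-moment analogue for the odd singular factor, proved here)] -/
theorem sum_even_oddSingularFactor_pow16_le (x : ℕ) :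
    ∑ n ∈ (Ioc 0 x).filter Even, oddSingularFactor n ^ 16 ≤ 2.15e6 * (x : ℝ) := by
  have h1 := sum_even_oddSingularFactor_pow16_le_prod x
  have h2 := prod_g16Factor_le ((range (x + 1)).filter (fun p => p.Prime ∧ 2 < p))
    (fun p hp => (mem_filter.mp hp).2)
  have hx : (0 : ℝ) ≤ (x : ℝ) / 2 := by positivity
  calc _ ≤ _ := h1
    _ ≤ (x : ℝ) / 2 * 4.3e6 := mul_le_mul_of_nonneg_left h2 hx
    _ = 2.15e6 * (x : ℝ) := by ring

/-- Hölder, exponent 16: `(Σ_T u)¹⁶ ≤ |T|¹⁵·Σ_T u¹⁶` for `u ≥ 0` (one Cauchy–Schwarz step on top of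
`pow8_sum_le`). [folklore] -/
private theorem pow16_sum_le (T : Finset ℕ) (u : ℕ → ℝ) (hu : ∀ n ∈ T, 0 ≤ u n) :
    (∑ n ∈ T, u n) ^ 16 ≤ (#T : ℝ) ^ 15 * ∑ n ∈ T, u n ^ 16 := by
  set m : ℝ := (#T : ℝ) with hm
  have hm0 : 0 ≤ m := by positivity
  have h8 := pow8_sum_le T u hu
  have hS1 : 0 ≤ ∑ n ∈ T, u n := sum_nonneg hu
  have hS8 : 0 ≤ ∑ n ∈ T, u n ^ 8 := sum_nonneg fun n _ => by positivity
  have h16 : (∑ n ∈ T, u n ^ 8) ^ 2 ≤ m * ∑ n ∈ T, u n ^ 16 := by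
    have h := sq_sum_le_card_mul_sum_sq T (fun n => u n ^ 8)
    have e : ∑ n ∈ T, (u n ^ 8) ^ 2 = ∑ n ∈ T, u n ^ 16 := sum_congr rfl fun n _ => by ring
    rw [e] at h
    exact h
  have h8' : ((∑ n ∈ T, u n) ^ 8) ^ 2 ≤ (m ^ 7 * ∑ n ∈ T, u n ^ 8) ^ 2 :=
    pow_le_pow_left₀ (by positivity) h8 2
  calc (∑ n ∈ T, u n) ^ 16 = ((∑ n ∈ T, u n) ^ 8) ^ 2 := by ring
    _ ≤ (m ^ 7 * ∑ n ∈ T, u n ^ 8) ^ 2 := h8'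
    _ = m ^ 14 * (∑ n ∈ T, u n ^ 8) ^ 2 := by ring
    _ ≤ m ^ 14 * (m * ∑ n ∈ T, u n ^ 16) := mul_le_mul_of_nonneg_left h16 (by positivity)
    _ = m ^ 15 * ∑ n ∈ T, u n ^ 16 := by ring

/-- **The Hölder-16 count**: `2.15·10⁶·κ¹⁵ < (c₀²/(2A) − 10⁻⁴)¹⁶` suffices. [cite: Nathanson1996, Thm 7.8 (difference analogue, Hölder-16, explicit; proved here)] -/
theorem even_count_ge_of16 {c₀ A Λ κ : ℝ} {x₁ : ℕ} (hc₀ : 0.9 ≤ c₀) (hc₁ : c₀ ≤ 1) (hA : 1 ≤ A)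
    (hA' : A ≤ 100) (hΛ : 38 ≤ Λ) (hx₁ : (x₁ : ℝ) ≤ Real.exp Λ) (hπ : PrimeCountingLowerMul c₀ x₁)
    (hpair : ∀ N h : ℕ, Real.exp Λ ≤ N → h ≠ 0 → Even h →
      ((#{q ∈ Nat.primesLE N | (q + h).Prime} : ℕ) : ℝ)
        ≤ A * oddSingularFactor h * (N : ℝ) / Real.log (N : ℝ) ^ 2)
    (hκ0 : 0 ≤ κ) (hκ : 2.15e6 * κ ^ 15 < (c₀ ^ 2 / (2 * A) - 1e-4) ^ 16)
    {N : ℕ} (hN : Real.exp Λ ≤ N) :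
    κ * N ≤ ((#{h ∈ Icc 1 N | Even h ∧ ∃ p q : ℕ, p.Prime ∧ q.Prime ∧ p ≤ N ∧ q + h = p} : ℕ) : ℝ) :=
  even_count_ge_of_moment 15 hc₀ hc₁ hA hA' hΛ hx₁ hπ hpair sum_even_oddSingularFactor_pow16_le
    pow16_sum_le hκ0 hκ hN

/-! ## §6 Assembly -/

/-- `227 ≤ e¹⁹⁰`. [folklore] -/
private theorem le_exp_190 : (227 : ℝ) ≤ Real.exp 190 := by
  have := exp_38_ge.trans (Real.exp_le_exp.mpr (by norm_num : (38 : ℝ) ≤ 190)); linarith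

/-- Mid range, parametric: for `N ≥ e³⁸` and `π(n) ≥ c₀ n/log n` (`n ≥ x₁`, `x₁ ≤ N`):
`3c₀·N/log N − 9 − 39.03·N/log²N ≤ #{even differences ≤ N}`. [folklore] -/
private theorem evenDiffSet_card_ge_mid {c₀ : ℝ} {x₁ N : ℕ} (hπ : PrimeCountingLowerMul c₀ x₁) (hx₁ : x₁ ≤ N)
    (h38 : Real.exp 38 ≤ N) :
    3 * (c₀ * N / Real.log N) - 9 - 39.03 * N / Real.log N ^ 2 ≤ #(evenDiffSet N) := by
  have h1 := evenDiffSet_card_ge_three_shifts h38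
  have h2 : c₀ * N / Real.log N ≤ Nat.primeCounting N := hπ N hx₁
  linarith

/-- **Assembly, parametric in the column.**  If `π(n) ≥ c₀ n/log n` for `n ≥ x₁` (`x₁ ≤ 227`,
`0.9636 ≤ c₀`), `76 ≤ K`, and the large range `N ≥ e¹⁹⁰` has `N/K ≤ #{even differences ≤ N}`, then
`N/K ≤ #{even differences ≤ N}` for every `N ≥ 5` (small `N` by `{2}`, `{2,4,6,8,10}`; `227 ≤ N < e³⁸`
by one shift; `e³⁸ ≤ N < e¹⁹⁰` by three shifts). [cite: Nathanson1996, Thm 7.8 (difference analogue: all-N assembly from shifted primes + the large-range count; proved here)] -/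
theorem even_floor_assemble {c₀ K : ℝ} {x₁ : ℕ} (hπ : PrimeCountingLowerMul c₀ x₁) (hx₁ : x₁ ≤ 227)
    (hc₀ : 0.9636 ≤ c₀) (hK : 76 ≤ K)
    (hlarge : ∀ N : ℕ, Real.exp 190 ≤ N → (N : ℝ) / K ≤ #(evenDiffSet N))
    {N : ℕ} (hN : 5 ≤ N) : (N : ℝ) / K ≤ #(evenDiffSet N) := by
  have hN0 : (0 : ℝ) < N := by exact_mod_cast (show 0 < N by omega)
  have hK0 : (0 : ℝ) < K := by linarith
  have hNK : (N : ℝ) / K ≤ N / 76 := div_le_div_of_nonneg_left hN0.le (by norm_num) hK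
  by_cases h13 : N < 13
  · have : (N : ℝ) ≤ 12 := by exact_mod_cast (show N ≤ 12 by omega)
    have := one_le_card_evenDiffSet hN
    linarith
  push Not at h13
  by_cases h227 : N < 227
  · have : (N : ℝ) ≤ 226 := by exact_mod_cast (show N ≤ 226 by omega)
    have := five_le_card_evenDiffSet h13
    linarith
  push Not at h227
  have hNx₁ : x₁ ≤ N := hx₁.trans h227
  have hN227 : (227 : ℝ) ≤ N := by exact_mod_cast h227
  have hlog0 : 0 < Real.log N := Real.log_pos (by linarith)
  have hπ' : 0.9636 * N / Real.log N ≤ Nat.primeCounting N := by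
    have h1 : c₀ * N / Real.log N ≤ Nat.primeCounting N := hπ N hNx₁
    have h2 : 0.9636 * N / Real.log N ≤ c₀ * N / Real.log N := by
      apply div_le_div_of_nonneg_right _ hlog0.le
      nlinarith
    linarith
  rcases lt_or_ge (N : ℝ) (Real.exp 38) with h38 | h38
  · -- `227 ≤ N < e³⁸`: one shift
    have h1 := evenDiffSet_card_ge_one_shift N
    have hlog38 : Real.log N < 38 := by rw [Real.log_lt_iff_lt_exp hN0]; exact h38
    have h3 : 0.9636 * N / 38 ≤ 0.9636 * N / Real.log N :=
      div_le_div_of_nonneg_left (by positivity) hlog0 hlog38.le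
    have h4 : (N : ℝ) / 76 ≤ 0.9636 * N / 38 - 2 := by
      rw [div_le_iff₀ (by norm_num : (0 : ℝ) < 76)]
      nlinarith
    linarith
  rcases lt_or_ge (N : ℝ) (Real.exp 190) with h190 | h190
  · -- `e³⁸ ≤ N < e¹⁹⁰`: three shifts
    have h1 := evenDiffSet_card_ge_three_shifts h38
    set L := Real.log N with hL
    have hL38 : 38 ≤ L := by rw [hL, Real.le_log_iff_exp_le hN0]; exact h38
    have hL190 : L ≤ 190 := by
      have : L < 190 := by rw [hL, Real.log_lt_iff_lt_exp hN0]; exact h190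
      exact this.le
    have hL0 : 0 < L := by linarith
    have hN16 : (1e16 : ℝ) ≤ N := exp_38_ge.trans h38
    have hq : 0.014 * L ^ 2 ≤ 2.8908 * L - 39.03 := by
      nlinarith [mul_nonneg (sub_nonneg.mpr hL38) (sub_nonneg.mpr hL190)]
    have hg : 0.014 * N ≤ 3 * (0.9636 * N / L) - 39.03 * N / L ^ 2 := by
      have e : 3 * (0.9636 * N / L) - 39.03 * N / L ^ 2 = N * (2.8908 * L - 39.03) / L ^ 2 := by
        field_simp; try ring
      rw [e, le_div_iff₀ (by positivity)]
      have := mul_le_mul_of_nonneg_left hq hN0.le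
      nlinarith
    have h4 : (N : ℝ) / 76 ≤ 0.014 * N - 9 := by
      rw [div_le_iff₀ (by norm_num : (0 : ℝ) < 76)]
      nlinarith
    linarith
  · exact hlarge N h190

/-- **Headline (even differences).**  For every `N ≥ 5`, at least `N/82` even numbers
`h ∈ [1, N]` are differences `p − q` of primes `q < p ≤ N`.  Inputs: Costa Pereira `0.9636`
(`n ≥ 227`), the tree's pair sieve `13.01` (`e³⁸`) / `11.52` (`e¹⁹⁰`), and the sixteenth moment
`2.15·10⁶` of §5 (`μ = 0.0402`, `μ¹⁶ = 4.65·10⁻²³ > 2.15·10⁶/82¹⁵ = 4.21·10⁻²³`).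
[cite: Pintz2013Polignac, §1 (Maillet numbers = differences of two primes have positive density; the explicit all-N level-N constant 1/82 is proved here)] -/
theorem even_maillet_floor {N : ℕ} (hN : 5 ≤ N) :
    (N : ℝ) / 82 ≤ ((#{h ∈ Icc 1 N | Even h ∧ ∃ p q : ℕ, p.Prime ∧ q.Prime ∧ p ≤ N ∧ q + h = p} : ℕ) : ℝ) := by
  have hπ : PrimeCountingLowerMul 0.9636 227 := fun n hn =>
    Literature.NumberTheory.LFunctions.CostaPereira.primeCounting_ge hn
  refine even_floor_assemble hπ le_rfl le_rfl (by norm_num) (fun N h190 => ?_) hN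
  have h := even_count_ge_of16 (c₀ := 0.9636) (A := 11.52) (Λ := 190) (κ := 1 / 82) (x₁ := 227)
    (by norm_num) (by norm_num) (by norm_num) (by norm_num) (by norm_num)
    (by have := le_exp_190; push_cast; linarith) hπ
    (fun N h hN hh hev => pairCount_le_1152 (N := N) (h := h) hN hh hev)
    (by norm_num) (by norm_num) h190
  have e : (N : ℝ) / 82 = 1 / 82 * N := by ring
  rw [e]; exact h

/-- **Headline (all differences).**  For every `N ≥ 3`, at least `N/82` numbers `h ∈ [1, N]`
are differences `p − q` of primes `q < p ≤ N` (Maillet numbers of level `N`). [cite: Pintz2013Polignac, §1 (Maillet numbers; explicit all-N constant 1/82 proved here)] -/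
theorem maillet_floor {N : ℕ} (hN : 3 ≤ N) :
    (N : ℝ) / 82 ≤ ((#{h ∈ Icc 1 N | ∃ p q : ℕ, p.Prime ∧ q.Prime ∧ p ≤ N ∧ q + h = p} : ℕ) : ℝ) := by
  show (N : ℝ) / 82 ≤ #(diffSet N)
  by_cases h5 : N < 5
  · have : (N : ℝ) ≤ 4 := by exact_mod_cast (show N ≤ 4 by omega)
    have := one_le_card_diffSet hN
    linarith
  · push Not at h5
    have h1 := even_maillet_floor h5
    have h2 : (#(evenDiffSet N) : ℝ) ≤ #(diffSet N) := by
      exact_mod_cast card_le_card (evenDiffSet_subset_diffSet N)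
    exact h1.trans h2

/-- The tree-moment-only column (Hölder-8 with `Σ f⁸ ≤ 259.55 x`, no §5): `N/88`
(`μ⁸ = 6.82·10⁻¹² > 259.55/88⁷ = 6.35·10⁻¹²`). [cite: Pintz2013Polignac, §1 (Maillet numbers; explicit all-N constant 1/88 from the eighth moment alone, proved here)] -/
theorem even_maillet_floor_holder8 {N : ℕ} (hN : 5 ≤ N) :
    (N : ℝ) / 88 ≤ ((#{h ∈ Icc 1 N | Even h ∧ ∃ p q : ℕ, p.Prime ∧ q.Prime ∧ p ≤ N ∧ q + h = p} : ℕ) : ℝ) := by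
  have hπ : PrimeCountingLowerMul 0.9636 227 := fun n hn =>
    Literature.NumberTheory.LFunctions.CostaPereira.primeCounting_ge hn
  refine even_floor_assemble hπ le_rfl le_rfl (by norm_num) (fun N h190 => ?_) hN
  have h := even_count_ge_of (c₀ := 0.9636) (A := 11.52) (Λ := 190) (κ := 1 / 88) (x₁ := 227)
    (by norm_num) (by norm_num) (by norm_num) (by norm_num) (by norm_num)
    (by have := le_exp_190; push_cast; linarith) hπ
    (fun N h hN hh hev => pairCount_le_1152 (N := N) (h := h) hN hh hev)
    (by norm_num) (by norm_num) h190
  have e : (N : ℝ) / 88 = 1 / 88 * N := by ring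
  rw [e]; exact h

/-- **Rosser–Schoenfeld column.**  Under `π(x) > x/log x` for `x ≥ 17` (Rosser–Schoenfeld 1962,
Corollary 1, (3.5); the hypothesis `PrimeCountingLowerMul 1 17`), the constant is `1/76`
(`μ = 1/23.04 − 10⁻⁴`, `μ¹⁶ = 1.53·10⁻²² > 2.15·10⁶/76¹⁵ = 1.32·10⁻²²`).
[cite: RosserSchoenfeld1962, Cor. 1 (3.5) (as hypothesis)] -/
theorem even_maillet_floor_RS (hRS : PrimeCountingLowerMul 1 17) {N : ℕ} (hN : 5 ≤ N) :
    (N : ℝ) / 76 ≤ ((#{h ∈ Icc 1 N | Even h ∧ ∃ p q : ℕ, p.Prime ∧ q.Prime ∧ p ≤ N ∧ q + h = p} : ℕ) : ℝ) := by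
  refine even_floor_assemble hRS (by norm_num) (by norm_num) le_rfl (fun N h190 => ?_) hN
  have h := even_count_ge_of16 (c₀ := 1) (A := 11.52) (Λ := 190) (κ := 1 / 76) (x₁ := 17)
    (by norm_num) (by norm_num) (by norm_num) (by norm_num) (by norm_num)
    (by have := le_exp_190; push_cast; linarith) hRS
    (fun N h hN hh hev => pairCount_le_1152 (N := N) (h := h) hN hh hev)
    (by norm_num) (by norm_num) h190
  have e : (N : ℝ) / 76 = 1 / 76 * N := by ring
  rw [e]; exact h

/-- The same for all differences, `N ≥ 3`, under Rosser–Schoenfeld. [cite: RosserSchoenfeld1962, Cor. 1 (3.5) (as hypothesis)] -/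
theorem maillet_floor_RS (hRS : PrimeCountingLowerMul 1 17) {N : ℕ} (hN : 3 ≤ N) :
    (N : ℝ) / 76 ≤ ((#{h ∈ Icc 1 N | ∃ p q : ℕ, p.Prime ∧ q.Prime ∧ p ≤ N ∧ q + h = p} : ℕ) : ℝ) := by
  show (N : ℝ) / 76 ≤ #(diffSet N)
  by_cases h5 : N < 5
  · have : (N : ℝ) ≤ 4 := by exact_mod_cast (show N ≤ 4 by omega)
    have := one_le_card_diffSet hN
    linarith
  · push Not at h5
    have h1 := even_maillet_floor_RS hRS h5
    have h2 : (#(evenDiffSet N) : ℝ) ≤ #(diffSet N) := by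
      exact_mod_cast card_le_card (evenDiffSet_subset_diffSet N)
    exact h1.trans h2

/-- `e¹⁹⁰ ≥ 10⁸⁰`. [folklore] -/
private theorem exp_190_ge : (1e80 : ℝ) ≤ Real.exp 190 := by
  have e : Real.exp 190 = Real.exp 38 ^ 5 := by
    rw [← Real.exp_nat_mul]; norm_num
  rw [e]
  calc (1e80 : ℝ) = (1e16 : ℝ) ^ 5 := by norm_num
    _ ≤ Real.exp 38 ^ 5 := pow_le_pow_left₀ (by norm_num) exp_38_ge 5

/-- **The `m = 68` Chebyshev column.**  Under `π(n) ≥ 0.984437·n/log n` for `n ≥ 4.468041·10⁴²`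
(the `m = 68` Costa-Pereira-type scheme of cell parity-ideate ROUND-44, kernel-certified there; taken here as
the hypothesis `PrimeCountingLowerMul 0.984437 4468041·10³⁶`, discharged by
`CostaPereira68.primeCounting_ge_9` once that file lands) the constant is `1/78`
(`μ = 0.984437²/23.04 − 10⁻⁴ = 0.041962`, `μ¹⁶ = 9.25·10⁻²³ > 2.15·10⁶/78¹⁵ = 8.93·10⁻²³`). [cite: Pintz2013Polignac, §1 (Maillet numbers; explicit constant 1/78 under the m = 68 Chebyshev bound, proved here)] -/
theorem even_maillet_floor_CP68
    (h68 : PrimeCountingLowerMul 0.984437 4468041000000000000000000000000000000000000) {N : ℕ}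
    (hN : 5 ≤ N) :
    (N : ℝ) / 78 ≤ ((#{h ∈ Icc 1 N | Even h ∧ ∃ p q : ℕ, p.Prime ∧ q.Prime ∧ p ≤ N ∧ q + h = p} : ℕ) : ℝ) := by
  have hπ : PrimeCountingLowerMul 0.9636 227 := fun n hn =>
    Literature.NumberTheory.LFunctions.CostaPereira.primeCounting_ge hn
  refine even_floor_assemble hπ le_rfl le_rfl (by norm_num) (fun N h190 => ?_) hN
  have h := even_count_ge_of16 (c₀ := 0.984437) (A := 11.52) (Λ := 190) (κ := 1 / 78)
    (x₁ := 4468041000000000000000000000000000000000000)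
    (by norm_num) (by norm_num) (by norm_num) (by norm_num) (by norm_num)
    (by have := exp_190_ge; push_cast; linarith) h68
    (fun N h hN hh hev => pairCount_le_1152 (N := N) (h := h) hN hh hev)
    (by norm_num) (by norm_num) h190
  have e : (N : ℝ) / 78 = 1 / 78 * N := by ring
  rw [e]; exact h

/-! ## §8 The `m = 68` column discharged: `N/78` unconditionally (the Chebyshev bound is the tree theorem
`CostaPereira68.primeCounting_ge_9`, `ChebyshevCostaPereira68.lean`) -/

/-- **Unconditionally, at least `N/78` even `h ≤ N` are differences of two primes `≤ N`** (`N ≥ 5`): the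
`m = 68` column `even_maillet_floor_CP68` with its hypothesis supplied by the kernel-certified Chebyshev scheme
`Literature.NumberTheory.LFunctions.CostaPereira68.primeCounting_ge_9` (`π(n) ≥ 0.984437·n/log n`,
`n ≥ 227·30000⁹`). [cite: Pintz2013Polignac, §1 (Maillet numbers; explicit all-`N` constant `1/78` proved here)] -/
theorem even_maillet_floor_78 {N : ℕ} (hN : 5 ≤ N) :
    (N : ℝ) / 78 ≤ ((#{h ∈ Icc 1 N | Even h ∧ ∃ p q : ℕ, p.Prime ∧ q.Prime ∧ p ≤ N ∧ q + h = p} : ℕ) : ℝ) :=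
  even_maillet_floor_CP68
    (fun _ hn => Literature.NumberTheory.LFunctions.CostaPereira68.primeCounting_ge_9 hn) hN

/-- **Unconditionally, at least `N/78` numbers `h ≤ N` are differences of two primes `≤ N`** (`N ≥ 3`; for
`N < 5` the set contains `1 = 3 − 2`). [cite: Pintz2013Polignac, §1 (Maillet numbers; explicit all-`N` constant `1/78` proved here)] -/
theorem maillet_floor_78 {N : ℕ} (hN : 3 ≤ N) :
    (N : ℝ) / 78 ≤ ((#{h ∈ Icc 1 N | ∃ p q : ℕ, p.Prime ∧ q.Prime ∧ p ≤ N ∧ q + h = p} : ℕ) : ℝ) := by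
  show (N : ℝ) / 78 ≤ #(diffSet N)
  by_cases h5 : N < 5
  · have : (N : ℝ) ≤ 4 := by exact_mod_cast (show N ≤ 4 by omega)
    have := one_le_card_diffSet hN
    linarith
  · push Not at h5
    have h1 := even_maillet_floor_78 h5
    have h2 : (#(evenDiffSet N) : ℝ) ≤ #(diffSet N) := by
      exact_mod_cast card_le_card (evenDiffSet_subset_diffSet N)
    exact h1.trans h2

end Literature.NumberTheory.Sieve.MailletFloorExplicit
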